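import Summits.QuantumFields.YangMills.Theorems.BalabanUVNodesN14StubTwoTextVOptShellOfUndressedClassLawTVAndBinderK3V6
import Summits.QuantumFields.YangMills.Theorems.BalabanUVNodesN14BinderKeyCoarsening

/-!
# DAG node N14 (NE1′) — K3⁸ v6 STUB 2's TEXT AT THE ℓ¹-OPTIMAL SHELL SPLIT FROM LETTERS READ AT AN ARBITRARY KEY READING `kr`: node N14's binder and the undressed class-law TV
# BOTH AT THE COARSE KEY, plus dag-n20-w3's one-run deviation letters — the (t4)-ready («window key») edition of FILE 9's located word

Cell `pub-ymgap` (HUMAN RULING D-0062, Track A), WIDTH SEAT `pub-ymgap-dag-n14-w2` (NODE n14 = NE1′), generation 6, FILE 10; `--kind proof --supports stmt-QuantumFields-27366 --as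
helper` (K3⁸ `SpineGivenEndpointR13SepCoPHV`, skeleton v6 b4e55110ab73e679, stub 2 `stub_expansion13HV`; helper, NOT a discharge; count-neutral).  THEOREMS ONLY (0 `def`, 0 `instance`,
0 `sorry`).  Imports this seat's FILE 9 `…StubTwoTextVOptShellOfUndressedClassLawTVAndBinderK3V6` (p629074∕p630195; through it FILE 5∕6, dag-n20-w3's 13∕13b∕13R, dag-n20-d's 13K
`…SpineReadingOfRecord13CoPHK`, dag-n27-w1's `K3V6Defs`, dag-n27-c's `…VCut`) and FILE 7 `…N14BinderKeyCoarsening` (p620796: `mgfForm_push`) — all BY NAME; edits nothing.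

WHY.  FILE 9 located, for K3⁸ stub 2 on this lineage's road: «text ⇐ keyed live line + {UNDRESSED class-law TV of record, N14's binder}», both letters at v6's pinned FULL history key
`classSet₁₃ θ 0 g₀` — where the caricature says the TV letter FAILS (dag-n20-w5 (LS), dag-n20-w3 13P; this seat's A6-NOTE).  dag-n20-d's 13K reads the record's class weights at an
ARBITRARY key reading `kr : KeyReading₁₃ 2 0` (`classSetK₁₃`, `weightAK₁₃`, `weightBK₁₃` = fibre sums; the carriers stay the record's), and dag-n20-w3's 13L∕13R
`keyedShellWeight_crOfRecord₁₃V_optShell_of_keyReading_of_fibreDev` give v6's N21 conjunct `KeyedShellWeight cr⋆` from the two ℓ¹ letters for the `kr`-COARSE weights (constants `cK`)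
plus two ONE-RUN deviation letters (fraction `v`).  This file supplies the coarse ℓ¹ letters from N14's side: the coarse weights are in MGF form over the PUSHED class measures (FILE 7's
`mgfForm_push` on g2's `mgfForm_weightA₁₃ ∕ B₁₃`), so FILE 5's `l1Mismatch_dressed_of_undressed_noBad` AT THE COARSE KEY turns {N14's binder at `kr`, undressed coarse class-law TV
at `kr`} into 13R's coarse letters at the undressed coarse constants `c_K = log Σ_u weightBK K 0 − log Σ_u weightAK K 0` (= the fine constants: re-keying preserves totals, 13K).
* ★★★ `stubExpansion13HVText_optShell_of_liveLine_of_lettersAtKeyReading` — for EVERY key reading `kr`: K3⁸ v6 STUB 2's TEXT VERBATIM (`KeyedRatesHolderD4V`, the N16 guard UNREAD)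
  from the keyed live line + (H-ζ) and, per guarded admissible tuple, THREE LETTERS READ AT `kr`: (N14ₖᵣ) `TiltedMeanMatching 1 (classSetK₁₃ … kr) ∅ (prodObs_A) (pushed classMeasA₁₃)
  (prodObs_B) (pushed classMeasB₁₃) η`; (TV₀ₖᵣ) `∀ K, ∀ S ⊆ classSetK₁₃ … K, |Σ_S weightAK K 0 ∕ Σ weightAK K 0 − Σ_S weightBK K 0 ∕ Σ weightBK K 0| ≤ ρ₀ K`; (Devₖᵣ) 13R's two one-run
  deviation letters with summable `v ≥ 0`.  Witness `(0, sh⋆, crOfRecord₁₃V 0 sh⋆)`, `sh⋆` the ℓ¹-optimal shells at the coarse undressed constants.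
* ★ `spineGivenEndpointR13SepCoPHV_of_stubRatesVText_of_liveLine_of_lettersAtKeyReading` — K3⁸ BY NAME modulo stub 1's v6 text.
The dial interpolates: at the finest reading (TV₀, N14) are FILE 9's letters and (Dev) is the degenerate-fibre term; at the total collapse (TV₀) is EMPTY (one class), (N14) is the
UNKEYED whole-run tilted-mean matching and (Dev) is the full fine mismatch (13P: `= Z·TV` there).  The window key `wkey` (dag-n20-d, to be declared) is ONE instance `kr := wkey`.

HONEST FRAMING.  By-name bookkeeping ([folklore] finite sums + the cited modules); the three letters at `kr` and the live line are HYPOTHESES inhabited for no tuple (K0⁷ OPEN) and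
produced by nobody; (Devₖᵣ) and (N14ₖᵣ) are the two-run ∕ one-run content Bałaban's papers do NOT print for d = 4; NOT a proof of `stub_expansion13HV` nor of K3⁸; proves NO estimate
of the programme; NE1′ ∕ NE7 ∕ NE7b ∕ NE7c NOT PRINTED, NOT proved; N14 ∕ N19 ∕ N20 ∕ N21 ∕ N27 NOT discharged; K3⁸ OPEN, v6 STANDS, not claimed; counts UNMOVED (typed 28∕28 ·
discharged 5∕28).  One finite 𝕋⁴ programme at fixed ε; R4 closes only the CONDITIONAL finite-𝕋⁴ rung `BalabanLadder.UV` — NOT ℝ⁴, NOT OS, NOT the Yang–Mills mass gap (Clay),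
which is NOT proved by any of this.
-/

set_option autoImplicit false

noncomputable section

open MeasureTheory ProbabilityTheory Finset
open scoped ENNReal BigOperators Matrix.Norms.L2Operator

namespace YMDAG.N14.StubTwoTextVAtKeyReading

open Literature.MathematicalPhysics.QuantumFieldTheory.Balaban1983to89
open Literature.MathematicalPhysics.QuantumFieldTheory.Balaban1983to89.T4Continuum
open Literature.MathematicalPhysics.QuantumFieldTheory.Balaban1983to89.Node00
open Summit.QuantumFields.BalabanUV.T4Continuum.Spine
open Summit.QuantumFields.BalabanUV.T4Continuum.NE1p.DressedMGFForm (MGFForm TiltedMeanMatching)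
open Summit.QuantumFields.YangMills.Theorems.K3V5Defs (SpineReading RateReadingFn RunSel LetterReading CutReading rrOfRecord GuardedReadingN16
  KeyedRelWeight KeyedShellWeight LiveSel PinnedAtLive)
open Summit.QuantumFields.YangMills.Theorems.K3V6Defs (KeyedRatesHolderD4V KeyedCoreEdgeHolderD4V KeyedExtractionV keyedExtractionV_of_bFree
  spineGivenEndpointR13SepCoPHV_of_stubTextsV)
open Summit.QuantumFields.YangMills.BalabanUVNodes.N20CoreEdgeShellDial (exists_optShellSplit)
open Summit.QuantumFields.YangMills.BalabanUVNodes.N20CoreEdgeShellDialStubTextK3V6 (pinned_relWeight_coreEdgeV_optShell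
  keyedShellWeight_crOfRecord₁₃V_optShell_of_keyReading_of_fibreDev)
open Summit.QuantumFields.YangMills.BalabanUVNodes.N21KeyedShellWeightShellZero (zeta_nonneg_of_provisos₁₃CoPH)
open YMDAG.UVSplit hiding SU
open YMDAG.N14.AtSpineReading13CoPH
open YMDAG.N14.L1MismatchOfBinderAndClassLawTV (l1Mismatch_dressed_of_undressed_noBad summable_noBadBudget)
open YMDAG.N14.BinderKeyCoarsening (mgfForm_push)
open YMDAG.N14.StubTwoTextVOfUndressedClassLawTVAndBinder (keyedExtractionBFree_crOfRecord₁₃V_of_liveLine)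

variable (kr : KeyReading₁₃ 2 0)

/-- **★★★ K3⁸ v6 STUB 2's TEXT, VERBATIM, AT `(0, sh⋆)` FROM THE KEYED LIVE LINE AND THREE LETTERS READ AT AN ARBITRARY KEY READING `kr`** — per guarded admissible tuple: (N14ₖᵣ)
node N14's binder for the `kr`-COARSE classes over the PUSHED class measures of record; (TV₀ₖᵣ) the UNDRESSED per-set class-law TV of the `kr`-coarse class weights; (Devₖᵣ)
dag-n20-w3's two one-run deviation letters (summable `v ≥ 0`).  `KeyedRatesHolderD4V` and the N16 guard UNREAD.  Witness `(0, sh⋆, crOfRecord₁₃V 0 sh⋆)` with `sh⋆` the ℓ¹-optimal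
shells at the coarse undressed constants `c_K = log Σ_u weightBK₁₃ K 0 u − log Σ_u weightAK₁₃ K 0 u`; faces: pin ∕ N20 ∕ N19′ᵛ (13R `pinned_relWeight_coreEdgeV_optShell`) · N21 (13R
`keyedShellWeight_crOfRecord₁₃V_optShell_of_keyReading_of_fibreDev`, its coarse ℓ¹ letters by FILE 5's `l1Mismatch_dressed_of_undressed_noBad` at the coarse key in the MGF form
`mgfForm_push (mgfForm_weightA₁₃ …) kr`; positivity of the coarse totals = of the fine totals (13K `sum_weightAK₁₃_eq`) = E1∕E2 + `schemeZ_pos_datumOfRecord₁₃CoPH`) · N27xᵛ (FILE 9's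
`keyedExtractionBFree_crOfRecord₁₃V_of_liveLine` + the mirror's transfer).  NOT a proof of `stub_expansion13HV`. [bookkeeping] -/
theorem stubExpansion13HVText_optShell_of_liveLine_of_lettersAtKeyReading
    (hlive : ∀ (F : T4Family) (θ : Stage13HParams F 2), θ.Provisos₁₃CoPH F 2 → (θ.ZhUnity F 2 ∧ θ.SlotsNondegenerate₁₃ F 2) → θ.Admissible F 2 →
      LiveSel F θ ∧ ZetaMeasurable F 2 θ.ζ)
    (hkr : ∀ (F : T4Family) (θ : Stage13HParams F 2) (hP : θ.Provisos₁₃CoPH F 2), (θ.ZhUnity F 2 ∧ θ.SlotsNondegenerate₁₃ F 2) → θ.Admissible F 2 →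
      ∀ (g₀ : ℕ → ℝ) (os : List (ULoop F)), ∃ η ρ₀ v : ℕ → ℝ, (∀ K, 0 ≤ η K) ∧ Summable η ∧ Summable ρ₀ ∧ (∀ K, 0 ≤ v K) ∧ Summable v ∧
        (letI : ∀ Kc, DecidableEq (SiteSeqKey F Kc) := fun _ => Classical.decEq _
         TiltedMeanMatching 1 (classSetK₁₃ θ 0 g₀ (kr F θ hP g₀ os)) (fun _ _ => ∅)
          (fun K (U : GaugeField (F.P (0 + K)) 0 (Node00.SU 2)) => T4GenFunBounds.prodObs ((datumOfRecord₁₃CoPH F 2 θ hP).scheme g₀) (0 + K) os U)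
          (fun K u => ∑ x ∈ (classSet₁₃ θ 0 g₀ K).filter (fun x => kr F θ hP g₀ os K x = u), classMeasA₁₃ θ 0 g₀ K x)
          (fun K (U : GaugeField (F.P (0 + K + 1)) 0 (Node00.SU 2)) => T4GenFunBounds.prodObs ((datumOfRecord₁₃CoPH F 2 θ hP).scheme g₀) (0 + K + 1) os U)
          (fun K u => ∑ x ∈ (classSet₁₃ θ 0 g₀ K).filter (fun x => kr F θ hP g₀ os K x = u), classMeasB₁₃ θ 0 g₀ K x) η) ∧
        (∀ (K : ℕ), ∀ S ⊆ classSetK₁₃ θ 0 g₀ (kr F θ hP g₀ os) K,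
          |(∑ u ∈ S, weightAK₁₃ θ hP 0 g₀ os (kr F θ hP g₀ os) K 0 u) / (∑ u ∈ classSetK₁₃ θ 0 g₀ (kr F θ hP g₀ os) K, weightAK₁₃ θ hP 0 g₀ os (kr F θ hP g₀ os) K 0 u)
            - (∑ u ∈ S, weightBK₁₃ θ hP 0 g₀ os (kr F θ hP g₀ os) K 0 u) / (∑ u ∈ classSetK₁₃ θ 0 g₀ (kr F θ hP g₀ os) K, weightBK₁₃ θ hP 0 g₀ os (kr F θ hP g₀ os) K 0 u)|
            ≤ ρ₀ K) ∧
        (∀ (K : ℕ) (t : ℝ), |t| ≤ 1 →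
          (∑ x ∈ classSet₁₃ θ 0 g₀ K, max 0 (weightA₁₃ θ hP 0 g₀ os K t x -
              weightAK₁₃ θ hP 0 g₀ os (kr F θ hP g₀ os) K t ((kr F θ hP g₀ os) K x) / weightBK₁₃ θ hP 0 g₀ os (kr F θ hP g₀ os) K t ((kr F θ hP g₀ os) K x) *
                weightB₁₃ θ hP 0 g₀ os K t x)
              ≤ v K * ∑ x ∈ classSet₁₃ θ 0 g₀ K, weightA₁₃ θ hP 0 g₀ os K t x) ∧
          (∑ x ∈ classSet₁₃ θ 0 g₀ K, max 0 (weightB₁₃ θ hP 0 g₀ os K t x -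
              weightBK₁₃ θ hP 0 g₀ os (kr F θ hP g₀ os) K t ((kr F θ hP g₀ os) K x) / weightAK₁₃ θ hP 0 g₀ os (kr F θ hP g₀ os) K t ((kr F θ hP g₀ os) K x) *
                weightA₁₃ θ hP 0 g₀ os K t x)
              ≤ v K * ∑ x ∈ classSet₁₃ θ 0 g₀ K, weightB₁₃ θ hP 0 g₀ os K t x))) :
    ∀ β : ℝ, 2 / 3 < β → β < 1 →
      ∀ (𝔯 : RateReading₁₃CoPH 2) (ksel : RunSel) (ℓ : LetterReading) (ℓ₃ : T4Family → Node00.NE3Letters₁₁) (g B : T4Family → ℝ),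
        GuardedReadingN16 𝔯 ksel ℓ ℓ₃ g B → KeyedRatesHolderD4V β (rrOfRecord 𝔯 ksel) →
        ∃ (jc : CutReading) (sh : ShellSplit₁₃CoPH 2 0) (cr : SpineReading), PinnedAtLive jc sh cr ∧
          KeyedRelWeight cr ∧ KeyedShellWeight cr ∧ KeyedExtractionV cr ∧ KeyedCoreEdgeHolderD4V β cr (rrOfRecord 𝔯 ksel) := by
  intro β _ _ 𝔯 ksel ℓ ℓ₃ g Bφ _ _
  -- the constant reading: the coarse undressed log-ratio of the totals
  obtain ⟨sh, hsh⟩ := exists_optShellSplit (N := 2) 0 (fun F θ hP g₀ os K =>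
    Real.log (∑ u ∈ classSetK₁₃ θ 0 g₀ (kr F θ hP g₀ os) K, weightBK₁₃ θ hP 0 g₀ os (kr F θ hP g₀ os) K 0 u) -
      Real.log (∑ u ∈ classSetK₁₃ θ 0 g₀ (kr F θ hP g₀ os) K, weightAK₁₃ θ hP 0 g₀ os (kr F θ hP g₀ os) K 0 u))
  obtain ⟨hpin, hrel, hcoreV⟩ := pinned_relWeight_coreEdgeV_optShell sh _ hsh β (rrOfRecord 𝔯 ksel)
  refine ⟨fun _ _ _ _ _ _ => 0, sh, fun F θ hP g₀ os => crOfRecord₁₃V (fun _ => 0) sh F θ hP g₀ os, hpin, hrel, ?_,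
    keyedExtractionV_of_bFree (keyedExtractionBFree_crOfRecord₁₃V_of_liveLine (fun _ _ _ _ _ _ => 0) sh hlive), hcoreV⟩
  -- `KeyedShellWeight` — 13R's key-reading road, its coarse ℓ¹ letters from N14's side
  refine keyedShellWeight_crOfRecord₁₃V_optShell_of_keyReading_of_fibreDev (fun _ _ _ _ _ _ => 0) sh _ hsh kr ?_
  intro F θ hP hG hθ g₀ os
  obtain ⟨hsel, hζm⟩ := hlive F θ hP hG hθ
  obtain ⟨η, ρ₀, v, hη0, hηs, hρ0s, hv0, hvs, hTM, hρ0, hdev⟩ := hkr F θ hP hG hθ g₀ os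
  letI : ∀ Kc, DecidableEq (SiteSeqKey F Kc) := fun _ => Classical.decEq _
  -- the coarse class weights of record are in MGF form over the pushed class measures (FILE 7 on g2)
  have hA := mgfForm_push (mgfForm_weightA₁₃ θ 0 hP (EOfRecord₁₃ F 2 θ.toStage13Params) hsel hζm (zeta_nonneg_of_provisos₁₃CoPH F θ hP) g₀ os) (kr F θ hP g₀ os)
  have hB := mgfForm_push (mgfForm_weightB₁₃ θ 0 hP (EOfRecord₁₃ F 2 θ.toStage13Params) hsel hζm (zeta_nonneg_of_provisos₁₃CoPH F θ hP) g₀ os) (kr F θ hP g₀ os)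
  -- positivity of the coarse undressed totals: they ARE the fine totals (13K), i.e. `Z_{0+K}(0)`, `Z_{0+K+1}(0)` (E1∕E2), positive
  have hZA0 : ∀ K, 0 < ∑ u ∈ classSetK₁₃ θ 0 g₀ (kr F θ hP g₀ os) K, weightAK₁₃ θ hP 0 g₀ os (kr F θ hP g₀ os) K 0 u := fun K => by
    rw [sum_weightAK₁₃_eq, ← schemeZ_eq_sum_classSet_weightA 0 θ hP (EOfRecord₁₃ F 2 θ.toStage13Params) hsel (localBgMeasurable F 2 θ.ν) hζm
      (zeta_nonneg_of_provisos₁₃CoPH F θ hP) g₀ os K 0]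
    exact Summit.QuantumFields.YangMills.Theorems.N20AtRecord13.schemeZ_pos_datumOfRecord₁₃CoPH θ hP g₀ os (0 + K) 0
  have hZB0 : ∀ K, 0 < ∑ u ∈ classSetK₁₃ θ 0 g₀ (kr F θ hP g₀ os) K, weightBK₁₃ θ hP 0 g₀ os (kr F θ hP g₀ os) K 0 u := fun K => by
    rw [sum_weightBK₁₃_eq, ← schemeZ_succ_eq_sum_classSet_weightB 0 θ hP (EOfRecord₁₃ F 2 θ.toStage13Params) hsel (localBgMeasurable F 2 θ.ν) hζm
      (zeta_nonneg_of_provisos₁₃CoPH F θ hP) g₀ os K 0]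
    exact Summit.QuantumFields.YangMills.Theorems.N20AtRecord13.schemeZ_pos_datumOfRecord₁₃CoPH θ hP g₀ os (0 + K + 1) 0
  -- FILE 5 at the coarse key
  have hmis := fun K (t : ℝ) (ht : |t| ≤ 1) =>
    l1Mismatch_dressed_of_undressed_noBad (T := classSetK₁₃ θ 0 g₀ (kr F θ hP g₀ os)) hA hB hTM hη0 hρ0 hZA0 hZB0 K ht
  refine ⟨_, v, fun K => ?_, summable_noBadBudget (B := (1 : ℝ)) zero_le_one hρ0s hηs hη0, hv0, hvs,
    fun K t ht => ⟨(hmis K t ht).2, (hmis K t ht).1, hdev K t ht⟩⟩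
  have h := (hmis K 0 (by rw [abs_zero]; exact zero_le_one)).2
  exact (mul_nonneg_iff_of_pos_right (hZA0 K)).mp ((Finset.sum_nonneg fun _ _ => le_max_left _ _).trans h)

/-- **★ K3⁸ BY NAME MODULO STUB 1's v6 TEXT — KEY-READING EDITION**: stub 1's registered v6 text + the keyed live line + (H-ζ) + the THREE letters read at `kr` ⇒
`SpineGivenEndpointR13SepCoPHV` (ONE application of the mirror's `spineGivenEndpointR13SepCoPHV_of_stubTextsV`).  NOT a proof of K3⁸ (stub 1's text and the letters are DISPLAYED,
inhabited for no tuple). [bookkeeping] -/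
theorem spineGivenEndpointR13SepCoPHV_of_stubRatesVText_of_liveLine_of_lettersAtKeyReading
    (h₁ : ∃ β : ℝ, 2 / 3 < β ∧ β < 1 ∧
      ∃ (𝔯 : RateReading₁₃CoPH 2) (ksel : RunSel) (ℓ : LetterReading) (ℓ₃ : T4Family → Node00.NE3Letters₁₁) (g B : T4Family → ℝ),
        GuardedReadingN16 𝔯 ksel ℓ ℓ₃ g B ∧ KeyedRatesHolderD4V β (rrOfRecord 𝔯 ksel))
    (hlive : ∀ (F : T4Family) (θ : Stage13HParams F 2), θ.Provisos₁₃CoPH F 2 → (θ.ZhUnity F 2 ∧ θ.SlotsNondegenerate₁₃ F 2) → θ.Admissible F 2 →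
      LiveSel F θ ∧ ZetaMeasurable F 2 θ.ζ)
    (hkr : ∀ (F : T4Family) (θ : Stage13HParams F 2) (hP : θ.Provisos₁₃CoPH F 2), (θ.ZhUnity F 2 ∧ θ.SlotsNondegenerate₁₃ F 2) → θ.Admissible F 2 →
      ∀ (g₀ : ℕ → ℝ) (os : List (ULoop F)), ∃ η ρ₀ v : ℕ → ℝ, (∀ K, 0 ≤ η K) ∧ Summable η ∧ Summable ρ₀ ∧ (∀ K, 0 ≤ v K) ∧ Summable v ∧
        (letI : ∀ Kc, DecidableEq (SiteSeqKey F Kc) := fun _ => Classical.decEq _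
         TiltedMeanMatching 1 (classSetK₁₃ θ 0 g₀ (kr F θ hP g₀ os)) (fun _ _ => ∅)
          (fun K (U : GaugeField (F.P (0 + K)) 0 (Node00.SU 2)) => T4GenFunBounds.prodObs ((datumOfRecord₁₃CoPH F 2 θ hP).scheme g₀) (0 + K) os U)
          (fun K u => ∑ x ∈ (classSet₁₃ θ 0 g₀ K).filter (fun x => kr F θ hP g₀ os K x = u), classMeasA₁₃ θ 0 g₀ K x)
          (fun K (U : GaugeField (F.P (0 + K + 1)) 0 (Node00.SU 2)) => T4GenFunBounds.prodObs ((datumOfRecord₁₃CoPH F 2 θ hP).scheme g₀) (0 + K + 1) os U)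
          (fun K u => ∑ x ∈ (classSet₁₃ θ 0 g₀ K).filter (fun x => kr F θ hP g₀ os K x = u), classMeasB₁₃ θ 0 g₀ K x) η) ∧
        (∀ (K : ℕ), ∀ S ⊆ classSetK₁₃ θ 0 g₀ (kr F θ hP g₀ os) K,
          |(∑ u ∈ S, weightAK₁₃ θ hP 0 g₀ os (kr F θ hP g₀ os) K 0 u) / (∑ u ∈ classSetK₁₃ θ 0 g₀ (kr F θ hP g₀ os) K, weightAK₁₃ θ hP 0 g₀ os (kr F θ hP g₀ os) K 0 u)
            - (∑ u ∈ S, weightBK₁₃ θ hP 0 g₀ os (kr F θ hP g₀ os) K 0 u) / (∑ u ∈ classSetK₁₃ θ 0 g₀ (kr F θ hP g₀ os) K, weightBK₁₃ θ hP 0 g₀ os (kr F θ hP g₀ os) K 0 u)|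
            ≤ ρ₀ K) ∧
        (∀ (K : ℕ) (t : ℝ), |t| ≤ 1 →
          (∑ x ∈ classSet₁₃ θ 0 g₀ K, max 0 (weightA₁₃ θ hP 0 g₀ os K t x -
              weightAK₁₃ θ hP 0 g₀ os (kr F θ hP g₀ os) K t ((kr F θ hP g₀ os) K x) / weightBK₁₃ θ hP 0 g₀ os (kr F θ hP g₀ os) K t ((kr F θ hP g₀ os) K x) *
                weightB₁₃ θ hP 0 g₀ os K t x)
              ≤ v K * ∑ x ∈ classSet₁₃ θ 0 g₀ K, weightA₁₃ θ hP 0 g₀ os K t x) ∧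
          (∑ x ∈ classSet₁₃ θ 0 g₀ K, max 0 (weightB₁₃ θ hP 0 g₀ os K t x -
              weightBK₁₃ θ hP 0 g₀ os (kr F θ hP g₀ os) K t ((kr F θ hP g₀ os) K x) / weightAK₁₃ θ hP 0 g₀ os (kr F θ hP g₀ os) K t ((kr F θ hP g₀ os) K x) *
                weightA₁₃ θ hP 0 g₀ os K t x)
              ≤ v K * ∑ x ∈ classSet₁₃ θ 0 g₀ K, weightB₁₃ θ hP 0 g₀ os K t x))) :
    Summit.QuantumFields.YangMills.Theses.BalabanUVNodes.SpineGivenEndpointR13SepCoPHV :=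
  spineGivenEndpointR13SepCoPHV_of_stubTextsV h₁ (stubExpansion13HVText_optShell_of_liveLine_of_lettersAtKeyReading kr hlive hkr)


/-! ## §2 (v1.1, APPEND-ONLY) THE N19′-ROAD TWIN AT A KEY READING — dressing the `kr`-coarse `NE7.Core` of record costs ONLY N14's binder at `kr`
(NE1′'s `core_of_mgfForm` at the coarse MGF forms `mgfForm_push (mgfForm_weightA₁₃ …) kr`; the shape the window-key card's assembly «(YG) + small-field channel ⇒ `NE7.Core` at the
fibre sums» consumes for the DRESSED fibre sums, its undressed sandwich being the N19′ lanes') -/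

/-- **★★ THE DRESSED COARSE CORE OF RECORD FROM THE UNDRESSED ONE AND N14's BINDER AT THE KEY READING** (any key reading `kr`, any coarse bad-key reading `bd`, on the keyed live line +
(H-ζ) at a tuple): if the UNDRESSED (`t = 0`) `kr`-coarse class weights of record are sandwiched on the good coarse classes with one constant per level and width `w K`, and N14's binder
holds at `kr` over the pushed class measures off the coarse bad classes with `η`, then for any `δ` with `w K + 1·η K ≤ vol·δ K` the DRESSED coarse weights satisfy
`NE7.Core 1 vol (classSetK₁₃ … kr) (badClassK₁₃ … kr bd) (weightAK₁₃ …) (weightBK₁₃ …) δ` — every `|t| ≤ 1`, the SAME constants.  NE1′'s `core_of_mgfForm` BY NAME at FILE 7's pushed MGF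
forms of g2's forms of record.  The undressed sandwich and the binder are HYPOTHESES (the N19′ lanes' (YG)∕small-field letters and N14's residual) — NOT PRINTED for d = 4, NOT proved.
[bookkeeping] -/
theorem coreK_dressed_of_undressed_of_binderAtKeyReading {F : T4Family} (θ : Stage13HParams F 2) (hP : θ.Provisos₁₃CoPH F 2)
    (hsel : LiveSel F θ) (hζm : ZetaMeasurable F 2 θ.ζ) (g₀ : ℕ → ℝ) (os : List (ULoop F))
    (bd : ℕ → (Σ K, SiteSeqKey F (0 + K)) → Prop) {vol : ℝ} {w η δ : ℕ → ℝ}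
    (h0 : letI : ∀ Kc, DecidableEq (SiteSeqKey F Kc) := fun _ => Classical.decEq _
      ∀ K : ℕ, ∃ c : ℝ, ∀ t : ℝ, |t| ≤ 1 → ∀ u ∈ classSetK₁₃ θ 0 g₀ (kr F θ hP g₀ os) K \ badClassK₁₃ θ 0 g₀ (kr F θ hP g₀ os) bd K t,
      Real.exp (c - w K) * weightAK₁₃ θ hP 0 g₀ os (kr F θ hP g₀ os) K 0 u ≤ weightBK₁₃ θ hP 0 g₀ os (kr F θ hP g₀ os) K 0 u ∧
        weightBK₁₃ θ hP 0 g₀ os (kr F θ hP g₀ os) K 0 u ≤ Real.exp (c + w K) * weightAK₁₃ θ hP 0 g₀ os (kr F θ hP g₀ os) K 0 u)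
    (hη : letI : ∀ Kc, DecidableEq (SiteSeqKey F Kc) := fun _ => Classical.decEq _
      TiltedMeanMatching 1 (classSetK₁₃ θ 0 g₀ (kr F θ hP g₀ os)) (badClassK₁₃ θ 0 g₀ (kr F θ hP g₀ os) bd)
        (fun K (U : GaugeField (F.P (0 + K)) 0 (Node00.SU 2)) => T4GenFunBounds.prodObs ((datumOfRecord₁₃CoPH F 2 θ hP).scheme g₀) (0 + K) os U)
        (fun K u => ∑ x ∈ (classSet₁₃ θ 0 g₀ K).filter (fun x => kr F θ hP g₀ os K x = u), classMeasA₁₃ θ 0 g₀ K x)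
        (fun K (U : GaugeField (F.P (0 + K + 1)) 0 (Node00.SU 2)) => T4GenFunBounds.prodObs ((datumOfRecord₁₃CoPH F 2 θ hP).scheme g₀) (0 + K + 1) os U)
        (fun K u => ∑ x ∈ (classSet₁₃ θ 0 g₀ K).filter (fun x => kr F θ hP g₀ os K x = u), classMeasB₁₃ θ 0 g₀ K x) η)
    (hw : ∀ K, w K + 1 * η K ≤ vol * δ K) :
    letI : ∀ Kc, DecidableEq (SiteSeqKey F Kc) := fun _ => Classical.decEq _
    Summit.QuantumFields.BalabanUV.T4Continuum.Spine.NE7.Core 1 vol (classSetK₁₃ θ 0 g₀ (kr F θ hP g₀ os))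
      (badClassK₁₃ θ 0 g₀ (kr F θ hP g₀ os) bd) (weightAK₁₃ θ hP 0 g₀ os (kr F θ hP g₀ os)) (weightBK₁₃ θ hP 0 g₀ os (kr F θ hP g₀ os)) δ := by
  letI : ∀ Kc, DecidableEq (SiteSeqKey F Kc) := fun _ => Classical.decEq _
  have hA := mgfForm_push (mgfForm_weightA₁₃ θ 0 hP (EOfRecord₁₃ F 2 θ.toStage13Params) hsel hζm (zeta_nonneg_of_provisos₁₃CoPH F θ hP) g₀ os) (kr F θ hP g₀ os)
  have hB := mgfForm_push (mgfForm_weightB₁₃ θ 0 hP (EOfRecord₁₃ F 2 θ.toStage13Params) hsel hζm (zeta_nonneg_of_provisos₁₃CoPH F θ hP) g₀ os) (kr F θ hP g₀ os)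
  exact Summit.QuantumFields.BalabanUV.T4Continuum.NE1p.DressedMGFForm.core_of_mgfForm (T := classSetK₁₃ θ 0 g₀ (kr F θ hP g₀ os)) hA hB h0 hη hw


/-! ## §3 (v1.2, APPEND-ONLY) WHERE (N14ₖᵣ) COMES FROM — N14's binder of record at the FULL key descends to ANY key reading at the price of a ONE-RUN fibre oscillation
(this seat's FILE 7 `tiltedMeanMatching_push_of_fibreOsc` at g2's MGF forms of record; FILE 8: the oscillation vanishes under exact decoupling of the observable from the forgotten slots) -/

/-- **★★ N14's BINDER AT A KEY READING FROM THE FINE BINDER OF RECORD PLUS A ONE-RUN FIBRE OSCILLATION** (any key reading `kr`, any coarse bad-key reading `bd`, on the keyed live line +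
(H-ζ) at a tuple): if N14's binder of record holds on ALL classes of the full key with `η` (FILE 9's letter), the fibres of the good coarse classes carry positive mass in both runs at every
tilt `|s| ≤ 1`, and run A's class-wise tilted means oscillate by at most `ω K` over each such fibre (ONE-RUN letter), then (N14ₖᵣ) holds off the coarse bad classes with `η + ω` — FILE 7's
`tiltedMeanMatching_push_of_fibreOsc` BY NAME.  No two-run statement beyond the fine binder is used. [bookkeeping] -/
theorem binderAtKeyReading_of_fineBinder_of_fibreOsc {F : T4Family} (θ : Stage13HParams F 2) (hP : θ.Provisos₁₃CoPH F 2)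
    (hsel : LiveSel F θ) (hζm : ZetaMeasurable F 2 θ.ζ) (g₀ : ℕ → ℝ) (os : List (ULoop F))
    (bd : ℕ → (Σ K, SiteSeqKey F (0 + K)) → Prop) {η ω : ℕ → ℝ}
    (hη : letI : DecidableEq (Σ K, SiteSeqKey F (0 + K)) := Classical.decEq _
      TiltedMeanMatching 1 (classSet₁₃ θ 0 g₀) (fun _ _ => ∅)
        (fun K (U : GaugeField (F.P (0 + K)) 0 (Node00.SU 2)) => T4GenFunBounds.prodObs ((datumOfRecord₁₃CoPH F 2 θ hP).scheme g₀) (0 + K) os U) (classMeasA₁₃ θ 0 g₀)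
        (fun K (U : GaugeField (F.P (0 + K + 1)) 0 (Node00.SU 2)) => T4GenFunBounds.prodObs ((datumOfRecord₁₃CoPH F 2 θ hP).scheme g₀) (0 + K + 1) os U) (classMeasB₁₃ θ 0 g₀)
        η)
    (hpos : letI : ∀ Kc, DecidableEq (SiteSeqKey F Kc) := fun _ => Classical.decEq _
      ∀ (K : ℕ) (t : ℝ), |t| ≤ 1 → ∀ u ∈ classSetK₁₃ θ 0 g₀ (kr F θ hP g₀ os) K \ badClassK₁₃ θ 0 g₀ (kr F θ hP g₀ os) bd K t, ∀ s : ℝ, |s| ≤ 1 →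
        0 < ∑ x ∈ (classSet₁₃ θ 0 g₀ K).filter (fun x => kr F θ hP g₀ os K x = u), weightA₁₃ θ hP 0 g₀ os K s x ∧
          0 < ∑ x ∈ (classSet₁₃ θ 0 g₀ K).filter (fun x => kr F θ hP g₀ os K x = u), weightB₁₃ θ hP 0 g₀ os K s x)
    (hω : letI : ∀ Kc, DecidableEq (SiteSeqKey F Kc) := fun _ => Classical.decEq _
      ∀ (K : ℕ) (t : ℝ), |t| ≤ 1 → ∀ u ∈ classSetK₁₃ θ 0 g₀ (kr F θ hP g₀ os) K \ badClassK₁₃ θ 0 g₀ (kr F θ hP g₀ os) bd K t,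
        ∀ x ∈ (classSet₁₃ θ 0 g₀ K).filter (fun x => kr F θ hP g₀ os K x = u), ∀ x' ∈ (classSet₁₃ θ 0 g₀ K).filter (fun x => kr F θ hP g₀ os K x = u), ∀ s : ℝ, |s| ≤ 1 →
          |Summit.QuantumFields.BalabanUV.T4Continuum.NE1p.DressedMGFForm.tiltedMean
              (fun (U : GaugeField (F.P (0 + K)) 0 (Node00.SU 2)) => T4GenFunBounds.prodObs ((datumOfRecord₁₃CoPH F 2 θ hP).scheme g₀) (0 + K) os U) (classMeasA₁₃ θ 0 g₀ K x) s -
            Summit.QuantumFields.BalabanUV.T4Continuum.NE1p.DressedMGFForm.tiltedMean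
              (fun (U : GaugeField (F.P (0 + K)) 0 (Node00.SU 2)) => T4GenFunBounds.prodObs ((datumOfRecord₁₃CoPH F 2 θ hP).scheme g₀) (0 + K) os U) (classMeasA₁₃ θ 0 g₀ K x') s|
            ≤ ω K) :
    letI : ∀ Kc, DecidableEq (SiteSeqKey F Kc) := fun _ => Classical.decEq _
    TiltedMeanMatching 1 (classSetK₁₃ θ 0 g₀ (kr F θ hP g₀ os)) (badClassK₁₃ θ 0 g₀ (kr F θ hP g₀ os) bd)
      (fun K (U : GaugeField (F.P (0 + K)) 0 (Node00.SU 2)) => T4GenFunBounds.prodObs ((datumOfRecord₁₃CoPH F 2 θ hP).scheme g₀) (0 + K) os U)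
      (fun K u => ∑ x ∈ (classSet₁₃ θ 0 g₀ K).filter (fun x => kr F θ hP g₀ os K x = u), classMeasA₁₃ θ 0 g₀ K x)
      (fun K (U : GaugeField (F.P (0 + K + 1)) 0 (Node00.SU 2)) => T4GenFunBounds.prodObs ((datumOfRecord₁₃CoPH F 2 θ hP).scheme g₀) (0 + K + 1) os U)
      (fun K u => ∑ x ∈ (classSet₁₃ θ 0 g₀ K).filter (fun x => kr F θ hP g₀ os K x = u), classMeasB₁₃ θ 0 g₀ K x) (fun K => η K + ω K) := by
  letI : ∀ Kc, DecidableEq (SiteSeqKey F Kc) := fun _ => Classical.decEq _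
  have hA := mgfForm_weightA₁₃ θ 0 hP (EOfRecord₁₃ F 2 θ.toStage13Params) hsel hζm (zeta_nonneg_of_provisos₁₃CoPH F θ hP) g₀ os
  have hB := mgfForm_weightB₁₃ θ 0 hP (EOfRecord₁₃ F 2 θ.toStage13Params) hsel hζm (zeta_nonneg_of_provisos₁₃CoPH F θ hP) g₀ os
  -- the fine binder at THIS instance of the (irrelevant, `Bad = ∅`) decidability
  have hη' : TiltedMeanMatching 1 (classSet₁₃ θ 0 g₀) (fun _ _ => ∅)
      (fun K (U : GaugeField (F.P (0 + K)) 0 (Node00.SU 2)) => T4GenFunBounds.prodObs ((datumOfRecord₁₃CoPH F 2 θ hP).scheme g₀) (0 + K) os U) (classMeasA₁₃ θ 0 g₀)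
      (fun K (U : GaugeField (F.P (0 + K + 1)) 0 (Node00.SU 2)) => T4GenFunBounds.prodObs ((datumOfRecord₁₃CoPH F 2 θ hP).scheme g₀) (0 + K + 1) os U) (classMeasB₁₃ θ 0 g₀)
      η := fun K t ht τ hτ s hs =>
    hη K t ht τ ((@Finset.mem_sdiff _ (Classical.decEq _) _ _ _).mpr ⟨(Finset.mem_sdiff.mp hτ).1, Finset.notMem_empty _⟩) s hs
  exact YMDAG.N14.BinderKeyCoarsening.tiltedMeanMatching_push_of_fibreOsc (T := classSet₁₃ θ 0 g₀) (f := kr F θ hP g₀ os)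
    (Bad' := badClassK₁₃ θ 0 g₀ (kr F θ hP g₀ os) bd) hA hB hη' (fun _ _ _ _ _ _ => Finset.notMem_empty _) hpos hω


/-! ## §4 (v1.3, APPEND-ONLY) WHERE (TV₀ₖᵣ) COMES FROM — the undressed per-set class-law TV of record CONTRACTS along every key reading, same radius
(dag-n20-w4's `abs_pushClassLaw_sub_le_of_classLaw` [folklore; data processing] at the record's undressed class weights).  With §3 this prices the whole dial against FILE 9's two
fine letters: (TV₀ₖᵣ) ≤ (TV₀) for free, (N14ₖᵣ) ≤ (N14) + one-run ω, and (Devₖᵣ) is the new one-run letter — the direction that matters is the converse (the fine (TV₀) is the letter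
expected to FAIL; the coarse one is what a window-key producer would supply). -/

/-- **★ (TV₀ₖᵣ) FROM THE FINE (TV₀), SAME RADIUS** (any key reading `kr`, any tuple; no live line needed): the undressed per-set class-law TV of the `kr`-coarse class weights of record
is at most that of the fine class weights — dag-n20-w4's `abs_pushClassLaw_sub_le_of_classLaw` BY NAME (the coarse difference on `S′` IS the fine difference on the preimage).
[bookkeeping] -/
theorem classLawTVAtKeyReading_of_fine {F : T4Family} (θ : Stage13HParams F 2) (hP : θ.Provisos₁₃CoPH F 2) (g₀ : ℕ → ℝ) (os : List (ULoop F)) {ρ₀ : ℕ → ℝ}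
    (hρ0 : ∀ (K : ℕ), ∀ S ⊆ classSet₁₃ θ 0 g₀ K,
      |(∑ x ∈ S, weightA₁₃ θ hP 0 g₀ os K 0 x) / (∑ x ∈ classSet₁₃ θ 0 g₀ K, weightA₁₃ θ hP 0 g₀ os K 0 x)
        - (∑ x ∈ S, weightB₁₃ θ hP 0 g₀ os K 0 x) / (∑ x ∈ classSet₁₃ θ 0 g₀ K, weightB₁₃ θ hP 0 g₀ os K 0 x)| ≤ ρ₀ K) :
    ∀ (K : ℕ), ∀ S ⊆ classSetK₁₃ θ 0 g₀ (kr F θ hP g₀ os) K,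
      |(∑ u ∈ S, weightAK₁₃ θ hP 0 g₀ os (kr F θ hP g₀ os) K 0 u) / (∑ u ∈ classSetK₁₃ θ 0 g₀ (kr F θ hP g₀ os) K, weightAK₁₃ θ hP 0 g₀ os (kr F θ hP g₀ os) K 0 u)
        - (∑ u ∈ S, weightBK₁₃ θ hP 0 g₀ os (kr F θ hP g₀ os) K 0 u) / (∑ u ∈ classSetK₁₃ θ 0 g₀ (kr F θ hP g₀ os) K, weightBK₁₃ θ hP 0 g₀ os (kr F θ hP g₀ os) K 0 u)|
        ≤ ρ₀ K := by
  letI : ∀ Kc, DecidableEq (SiteSeqKey F Kc) := fun _ => Classical.decEq _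
  intro K S hS
  exact Summit.QuantumFields.YangMills.BalabanUVNodes.N20ClassLawTVCoarsening.abs_pushClassLaw_sub_le_of_classLaw
    (T := classSet₁₃ θ 0 g₀ K) (f := kr F θ hP g₀ os K) (A := fun x => weightA₁₃ θ hP 0 g₀ os K 0 x) (B := fun x => weightB₁₃ θ hP 0 g₀ os K 0 x) (hρ0 K) hS

end YMDAG.N14.StubTwoTextVAtKeyReading

end
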